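import Literature.Computability.QuantumComplexity.ForrelationThm25Sign
import Literature.Computability.QuantumComplexity.Lemma24Transcribe
import HarnessLib

/-!
# Routing qubits with adjacent swaps: complements to `permGate` / `swapLayer`

Topic `Literature/Computability/QuantumComplexity`. Proof infrastructure for the
`PromiseBQP`-hardness of the Jones polynomial at `k = 5` (Aharonov–Arad 2011, Thm. 3.1): in the
four-strand encoding the two-qubit braid gadgets couple ADJACENT code blocks only, whereas the
gates of the simulated circuit sit on arbitrary wires; one routes with swaps of adjacent qubits
(§3.2, "we can assume the gates act on adjacent qubits by adding SWAP gates"). The library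
already has the wire permutations `permGate π : |y⟩ ↦ |y ∘ π⁻¹⟩` with the covariance
`permGate_mul_placeGate` and `placeGate_pairEmb_swapLayer` (`ForrelationThm25Sign.lean`), the
swap gate `swapLayer` (`ForrelationCompleteProofs.lean`) and `CNOT = H_t·CZ·H_t`
(`Lemma24.cnot_eq_hadamard_cz_hadamard`, `Lemma24Transcribe.lean`); they are REUSED here. New:

* `conjTranspose_permGate`, `permGate_mul_permGate_symm`, `permGate_mem_unitaryGroup` —
  `P_π` is unitary with `P_πᴴ = P_{π⁻¹}`; the conjugation form of covariance
  `permGate_mul_placeGate_mul_symm`;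
* `permGate_mulVec_zero`, `conj_permGate_apply_zero_zero` — `|0ⁿ⟩` is fixed, so amplitudes
  `⟨0ⁿ|·|0ⁿ⟩` are invariant under conjugation by wire permutations;
* `cnot'` (control on the second wire), `swapLayer_eq_cnot_mul` — **`SWAP = CNOT·CNOT'·CNOT`**,
  `placeGate_pairEmb_cnot'`, and `permGate_swap_eq_prod` — a transposition of wires is a product
  of placed `cz` and Hadamard gates (the exact network the reduction compiles gate by gate).

## References

* D. Aharonov, I. Arad, New J. Phys. 13 (2011) 035019, §3.2 [AharonovArad2011].
* M. A. Nielsen, I. L. Chuang, *Quantum Computation and Quantum Information*, CUP 2010, §1.3.4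
  (swap from three CNOTs), §4.3 [NielsenChuang2010].
-/

noncomputable section

namespace Literature.Computability.QuantumComplexity

open Matrix Cryptography

variable {n : ℕ}

/-! ### Unitarity and the conjugation form of covariance -/

/-- `P_π P_{π⁻¹} = 1`. [folklore] -/
theorem permGate_mul_permGate_symm (π : Equiv.Perm (Fin n)) : permGate π * permGate π.symm = 1 := by
  rw [permGate_mul_permGate, Equiv.symm_trans_self, permGate_refl]

/-- `P_{π⁻¹} P_π = 1`. [folklore] -/
theorem permGate_symm_mul_permGate (π : Equiv.Perm (Fin n)) : permGate π.symm * permGate π = 1 := by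
  rw [permGate_mul_permGate, Equiv.self_trans_symm, permGate_refl]

/-- `P_πᴴ = P_{π⁻¹}` (a real permutation matrix). [folklore] -/
theorem conjTranspose_permGate (π : Equiv.Perm (Fin n)) : (permGate π)ᴴ = permGate π.symm := by
  ext x y
  rw [conjTranspose_apply, permGate_apply, permGate_apply]
  have : (x = y ∘ π) ↔ (y = x ∘ π.symm) := by
    constructor
    · rintro rfl; funext i; simp
    · rintro rfl; funext i; simp
  by_cases h : x = y ∘ π
  · rw [if_pos h, if_pos (this.1 h), star_one]
  · rw [if_neg h, if_neg (fun h' => h (this.2 h')), star_zero]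

/-- `P_π ∈ U(2ⁿ)`. [folklore] -/
theorem permGate_mem_unitaryGroup (π : Equiv.Perm (Fin n)) : permGate π ∈ Matrix.unitaryGroup (QReg n) ℂ := by
  rw [Matrix.mem_unitaryGroup_iff, Matrix.star_eq_conjTranspose, conjTranspose_permGate, permGate_mul_permGate_symm]

/-- **Covariance, conjugation form**: `P_π · placeGate e U · P_{π⁻¹} = placeGate (e ∘ π) U`.
[cite: NielsenChuang2010, §4.3] -/
theorem permGate_mul_placeGate_mul_symm {k : ℕ} (π : Equiv.Perm (Fin n)) (e : Fin k ↪ Fin n)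
    (U : Matrix (QReg k) (QReg k) ℂ) :
    permGate π * placeGate e U * permGate π.symm = placeGate (e.trans π.toEmbedding) U := by
  rw [permGate_mul_placeGate, Matrix.mul_assoc, permGate_mul_permGate_symm, Matrix.mul_one]

/-! ### The all-zero state is fixed -/

/-- `P_π |y⟩ = |y ∘ π⁻¹⟩`. [cite: NielsenChuang2010, §1.3.4] -/
theorem permGate_mulVec_basisState (π : Equiv.Perm (Fin n)) (y : QReg n) :
    permGate π *ᵥ basisState y = basisState (y ∘ π.symm) := by
  funext x
  simp only [Matrix.mulVec, dotProduct, basisState_apply, mul_ite, mul_one, mul_zero, Finset.sum_ite_eq',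
    Finset.mem_univ, if_true, permGate_apply]
  have : (y = x ∘ π) ↔ (x = y ∘ π.symm) := by
    constructor
    · rintro rfl; funext i; simp
    · rintro rfl; funext i; simp
  by_cases h : y = x ∘ π
  · rw [if_pos h, if_pos (this.1 h)]
  · rw [if_neg h, if_neg (fun h' => h (this.2 h'))]

/-- **`P_π |0ⁿ⟩ = |0ⁿ⟩`.** [folklore] -/
theorem permGate_mulVec_zero (π : Equiv.Perm (Fin n)) :
    permGate π *ᵥ basisState (fun _ : Fin n => false) = basisState (fun _ => false) := by
  rw [permGate_mulVec_basisState]; rfl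

/-- **Amplitudes `⟨0ⁿ|·|0ⁿ⟩` are invariant under conjugation by wire permutations.** [folklore] -/
theorem conj_permGate_apply_zero_zero (π : Equiv.Perm (Fin n)) (M : Matrix (QReg n) (QReg n) ℂ) :
    (permGate π * M * permGate π.symm) (fun _ => false) (fun _ => false) = M (fun _ => false) (fun _ => false) := by
  rw [mul_permGate_apply, permGate_mul_apply]; rfl

/-! ### The swap of two wires from `CZ` and Hadamards -/

/-- The CNOT with control the SECOND wire: `|c, t⟩ ↦ |c ⊕ t, t⟩`. [cite: NielsenChuang2010, §1.3.4] -/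
def cnot' : Matrix (QReg 2) (QReg 2) ℂ := Matrix.of fun x y => if x 1 = y 1 ∧ x 0 = (y 0 ^^ y 1) then 1 else 0

/-- Sums over `QReg 2`, fully unfolded. [folklore] -/
theorem sum_qReg_two_explicit (f : QReg 2 → ℂ) :
    ∑ z : QReg 2, f z = f ![false, false] + f ![false, true] + f ![true, false] + f ![true, true] := by
  rw [sum_qReg_two]
  simp only [Fintype.sum_bool]
  ring

/-- A `QReg 2` label is determined by its two bits. [folklore] -/
theorem qReg_two_eq (x : QReg 2) : x = ![x 0, x 1] := by funext i; fin_cases i <;> rfl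

/-- **`SWAP = CNOT · CNOT' · CNOT`.** [cite: NielsenChuang2010, §1.3.4] -/
theorem swapLayer_eq_cnot_mul : swapLayer = cnot * cnot' * cnot := by
  ext x y
  rw [qReg_two_eq x, qReg_two_eq y]
  simp only [Matrix.mul_apply, sum_qReg_two_explicit, swapLayer, cnot, cnot', Matrix.of_apply, Matrix.cons_val_zero,
    Matrix.cons_val_one]
  rcases Bool.eq_false_or_eq_true (x 0) with a | a <;> rcases Bool.eq_false_or_eq_true (x 1) with b | b <;>
    rcases Bool.eq_false_or_eq_true (y 0) with c | c <;> rcases Bool.eq_false_or_eq_true (y 1) with d | d <;>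
    simp [a, b, c, d]

/-- `CNOT'` placed on `(i, j)` is `CNOT` placed on `(j, i)`. [folklore] -/
theorem placeGate_pairEmb_cnot' {i j : Fin n} (h : i ≠ j) : placeGate (pairEmb i j h) cnot' = placeGate (pairEmb j i h.symm) cnot := by
  ext x y
  rw [placeGate_apply, placeGate_apply]
  simp only [range_pairEmb, Set.mem_insert_iff, Set.mem_singleton_iff, not_or, cnot, cnot', Matrix.of_apply,
    Function.comp_apply, pairEmb_zero, pairEmb_one]
  have this : (∀ l : Fin n, ¬(l = i) ∧ ¬(l = j) → x l = y l) ↔ (∀ l : Fin n, ¬(l = j) ∧ ¬(l = i) → x l = y l) :=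
    ⟨fun h l hl => h l ⟨hl.2, hl.1⟩, fun h l hl => h l ⟨hl.2, hl.1⟩⟩
  by_cases hc : ∀ l : Fin n, ¬(l = i) ∧ ¬(l = j) → x l = y l
  · rw [if_pos hc, if_pos (this.1 hc)]
    split_ifs <;> rfl
  · rw [if_neg hc, if_neg (fun h' => hc (this.2 h'))]

/-- `wireEmb j 0 = j`. [folklore] -/
theorem wireEmb_apply_zero' (j : Fin n) : wireEmb j 0 = j := rfl

/-- **`1 ⊗ H` placed on the pair `(i, j)` is `H` on wire `j`.** [folklore] -/
theorem placeGate_pairEmb_hOnSnd {i j : Fin n} (h : i ≠ j) :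
    placeGate (pairEmb i j h) (placeGate (wireEmb (1 : Fin 2)) hGate) = placeGate (wireEmb j) hGate := by
  ext x y
  rw [placeGate_apply, placeGate_apply, placeGate_apply]
  have hr : ∀ l : Fin 2, l ∉ Set.range (wireEmb (1 : Fin 2)) ↔ l = 0 := by
    intro l; fin_cases l <;> simp [wireEmb]
  have hrw : ∀ l : Fin n, l ∉ Set.range (wireEmb j) ↔ ¬ l = j := by
    intro l; simp [wireEmb, eq_comm]
  simp only [range_pairEmb, Set.mem_insert_iff, Set.mem_singleton_iff, not_or, Function.comp_apply, pairEmb_zero,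
    hr, hrw, forall_eq]
  by_cases hall : ∀ l : Fin n, ¬ l = j → x l = y l
  · have hagree : ∀ l : Fin n, ¬(l = i) ∧ ¬(l = j) → x l = y l := fun l hl => hall l hl.2
    rw [if_pos hagree, if_pos (hall i h), if_pos hall]
    rfl
  · rw [if_neg hall]
    by_cases hagree : ∀ l : Fin n, ¬(l = i) ∧ ¬(l = j) → x l = y l
    · rw [if_pos hagree, if_neg]
      intro hxi
      apply hall
      intro l hl
      by_cases hli : l = i
      · subst hli; exact hxi
      · exact hagree l ⟨hli, hl⟩
    · rw [if_neg hagree]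

/-- **A transposition of wires from `CZ` and Hadamards**: `P_{(i j)}` is the product of three
CNOTs, each `H_t · CZ · H_t` with `t` the target. [cite: AharonovArad2011, §3.2] [cite: NielsenChuang2010, §1.3.4 and §4.3] -/
theorem permGate_swap_eq_prod {i j : Fin n} (h : i ≠ j) :
    permGate (Equiv.swap i j) =
      (placeGate (wireEmb j) hGate * placeGate (pairEmb i j h) cz * placeGate (wireEmb j) hGate) *
        (placeGate (wireEmb i) hGate * placeGate (pairEmb j i h.symm) cz * placeGate (wireEmb i) hGate) *
          (placeGate (wireEmb j) hGate * placeGate (pairEmb i j h) cz * placeGate (wireEmb j) hGate) := by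
  rw [← placeGate_pairEmb_swapLayer i j h, swapLayer_eq_cnot_mul, placeGate_mul_holds, placeGate_mul_holds,
    placeGate_pairEmb_cnot' h, Lemma24.cnot_eq_hadamard_cz_hadamard, placeGate_mul_holds, placeGate_mul_holds,
    placeGate_mul_holds, placeGate_mul_holds, placeGate_pairEmb_hOnSnd h, placeGate_pairEmb_hOnSnd h.symm]

end Literature.Computability.QuantumComplexity

end
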